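import Mathlib
import Summits.Ventures.LatticeQCDFlow.Scaling.SlabChainExpansion

/-!
# LatticeQCDFlow / Scaling — slab chains: the replica integral has leading term `2b β^{gτ}` —
# file 6 of the slab-chain proof of (LC) at every separation

HONEST FRAMING: exact (Metropolis-corrected) sampling algorithms for lattice gauge theory;
figures of merit are autocorrelation/cost numbers at stated couplings and volumes; no
continuum-physics claim.

Venture `LatticeQCDFlow` (cell pub-lqcd), topic `Scaling`, FANOUT row 30 (lean-1) — OUR WORK (LEAD
LINE 230 (G3′)).  The REPLICA INTEGRAL of a slab chain,
`J(β) = ∫∫ (x(η_0) − x(η'_0))(y(η_τ) − y(η'_τ)) Φ(η)Φ(η') ∏_h K_h(η) ∏_h K_h(η') d(ν_E ⊗ ν_E)`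
(`replicaJ`; `Φ` = the in-layer weight, `K_h` = the transfer kernels of `Scaling/SlabKernel.lean`),
is twice the numerator of the tilted covariance (sequel file).  Here:
**`replicaJ_sub_isBigO`** — under `SlabChain.Bounds`, the moment hypothesis `SlabChain.Moments`
of order `g ≥ 1`, `ρ` bounded measurable with vanishing marginals, `x, y` bounded measurable,
`1 ≤ τ` and `2τ ≤ n`:  `J(β) − 2 b β^{gτ} = O(β^{gτ+1})` at `β = 0`, where
`b = ∫ x(η_0) y(η_τ) ∏_{h<τ} ρ_h(η_h, η_{h+1}) dν_E` is the single-chain character integral.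
Assembly of the expansion over subsets `S` of slabs (`kernelProd_mul_kernelProd_eq_sum`): cut sets
contribute `0` (`integral_slabTerm_eq_zero_of_cut`), sets with `≥ τ+1` slabs contribute
`O(β^{g(τ+1)})` (`dT_unifO`, `UnifO.prod`, `UnifO.isBigO_integral`), and the short arc `[0, τ)`
contributes `2bβ^{gτ} + O(β^{gτ+1})` (`dT_leading_unifO`, `UnifO.prod_leading`,
`replica_leading_eq_two_mul`).  Elementary; nothing is cited as a fact; one `def` (`replicaJ`);
no `sorry`.
-/

noncomputable section

open MeasureTheory Filter Topology Asymptotics Finset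
open scoped Nat
open Literature.MathematicalPhysics.QuantumFieldTheory (JetEq BddAt)
open Summit.Ventures.LatticeQCDFlow.Theory2.Tilted

namespace Summit.Ventures.LatticeQCDFlow.Theory2.SlabChain

variable {n : ℕ} {E V : Type*} [MeasurableSpace E] [MeasurableSpace V]
  (μ : Measure E) (μV : Measure V) [IsProbabilityMeasure μ] [IsProbabilityMeasure μV]
  {D : SlabChain n E V} {Ma Ms : ℝ} {g : ℕ} {c : Fin (n + 1) → ℕ → ℂ}
  {ρ : Fin (n + 1) → E → E → ℂ} {Mρ : ℝ} {x y : E → ℝ} {Bx By : ℝ} {τ : Fin (n + 1)}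

/-- **The replica integral** `J(β)` of a slab chain with observables `x` at height `0` and `y` at
height `τ`. [folklore] -/
def replicaJ (D : SlabChain n E V) (μ : Measure E) (μV : Measure V) (x y : E → ℝ) (τ : Fin (n + 1))
    (β : ℂ) : ℂ :=
  ∫ q, (((x (q.1 0) - x (q.2 0)) * (y (q.1 τ) - y (q.2 τ)) : ℝ) : ℂ) *
      (D.layerWeight β q.1 * D.layerWeight β q.2) * (D.kernelProd μV β q.1 * D.kernelProd μV β q.2)
    ∂((Measure.pi fun _ : Fin (n + 1) => μ).prod (Measure.pi fun _ : Fin (n + 1) => μ))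

/-! ## 1. The replica observable and the layer weights: bounds -/

section Weights

variable (hD : D.Bounds Ma Ms) (hxb : ∀ e, |x e| ≤ Bx) (hyb : ∀ e, |y e| ≤ By)
include hxb hyb

omit [MeasurableSpace E] in
/-- Bound of the replica observable: `|(x − x')(y − y')| ≤ (2Bx)(2By)`. [folklore] -/
theorem norm_replicaObs_le (q : (Fin (n + 1) → E) × (Fin (n + 1) → E)) :
    ‖((((x (q.1 0) - x (q.2 0)) * (y (q.1 τ) - y (q.2 τ)) : ℝ) : ℂ))‖ ≤ (2 * Bx) * (2 * By) := by
  rw [Complex.norm_real, Real.norm_eq_abs, abs_mul]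
  have e1 : |x (q.1 0) - x (q.2 0)| ≤ 2 * Bx := by
    refine (abs_sub _ _).trans ?_
    have := hxb (q.1 0); have := hxb (q.2 0); linarith
  have e2 : |y (q.1 τ) - y (q.2 τ)| ≤ 2 * By := by
    refine (abs_sub _ _).trans ?_
    have := hyb (q.1 τ); have := hyb (q.2 τ); linarith
  exact mul_le_mul e1 e2 (abs_nonneg _) (by have := hxb (q.1 0); linarith [abs_nonneg (x (q.1 0))])

omit hxb hyb
include hD

/-- The product of the two layer weights is `exp(β(A(η) + A(η')))` with `|A + A'| ≤ 2(n+1)Ma`;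
its norm is at most `e^{2(n+1)Ma ‖β‖}`. [folklore] -/
theorem norm_layerWeight_mul_le (β : ℂ) (q : (Fin (n + 1) → E) × (Fin (n + 1) → E)) :
    ‖D.layerWeight β q.1 * D.layerWeight β q.2‖ ≤ Real.exp (‖β‖ * (2 * ((n + 1) * Ma))) := by
  rw [norm_mul]
  calc ‖D.layerWeight β q.1‖ * ‖D.layerWeight β q.2‖
      ≤ Real.exp (‖β‖ * ((n + 1) * Ma)) * Real.exp (‖β‖ * ((n + 1) * Ma)) :=
        mul_le_mul (norm_layerWeight_le hD β q.1) (norm_layerWeight_le hD β q.2) (norm_nonneg _)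
          (Real.exp_pos _).le
    _ = Real.exp (‖β‖ * (2 * ((n + 1) * Ma))) := by rw [← Real.exp_add]; ring_nf

/-- The layer-weight product is `UnifO 0`. [folklore] -/
theorem layerWeight_mul_unifO :
    UnifO 0 (fun β (q : (Fin (n + 1) → E) × (Fin (n + 1) → E)) =>
      D.layerWeight β q.1 * D.layerWeight β q.2) := by
  refine UnifO.of_norm_le_of_lt (C := Real.exp (2 * ((n + 1) * Ma))) one_pos fun β hβ q => ?_
  refine (norm_layerWeight_mul_le hD β q).trans (Real.exp_le_exp.2 ?_)
  have h0 : 0 ≤ 2 * ((n + 1) * Ma) := by have := hD.Ma_nonneg; positivity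
  calc ‖β‖ * (2 * ((n + 1) * Ma)) ≤ 1 * (2 * ((n + 1) * Ma)) :=
        mul_le_mul_of_nonneg_right hβ.le h0
    _ = _ := one_mul _

/-- The layer-weight product minus one is `UnifO 1` (`‖e^z − 1‖ ≤ ‖z‖ e^{‖z‖}`). [folklore] -/
theorem layerWeight_mul_sub_one_unifO :
    UnifO 1 (fun β (q : (Fin (n + 1) → E) × (Fin (n + 1) → E)) =>
      D.layerWeight β q.1 * D.layerWeight β q.2 - 1) := by
  set M2 : ℝ := 2 * ((n + 1) * Ma) with hM2
  have hM2pos : 0 ≤ M2 := by have := hD.Ma_nonneg; positivity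
  refine ⟨M2 * Real.exp M2, 1, one_pos, fun β hβ q => ?_⟩
  beta_reduce
  set A : ℝ := ∑ h, D.a h (q.1 h) + ∑ h, D.a h (q.2 h) with hA
  have hAb : |A| ≤ M2 := by
    rw [hA, hM2]
    refine (abs_add_le _ _).trans ?_
    have h1 : ∀ η : Fin (n + 1) → E, |∑ h, D.a h (η h)| ≤ (n + 1) * Ma := fun η => by
      refine (Finset.abs_sum_le_sum_abs _ _).trans ?_
      calc ∑ h, |D.a h (η h)| ≤ ∑ _h : Fin (n + 1), Ma := sum_le_sum fun h _ => hD.a_bound h _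
        _ = (n + 1) * Ma := by simp
    have := h1 q.1; have := h1 q.2; linarith
  have hW : D.layerWeight β q.1 * D.layerWeight β q.2 = Complex.exp (β * (A : ℂ)) := by
    simp only [layerWeight, ← Complex.exp_add, hA]
    push_cast
    ring_nf
  rw [hW]
  have hz : ‖β * (A : ℂ)‖ ≤ ‖β‖ * M2 := by
    rw [norm_mul, Complex.norm_real, Real.norm_eq_abs]
    exact mul_le_mul_of_nonneg_left hAb (norm_nonneg _)
  have h := Complex.norm_exp_sub_sum_le_norm_mul_exp (β * (A : ℂ)) 1
  simp only [range_one, sum_singleton, pow_zero, Nat.factorial_zero, Nat.cast_one, div_one,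
    pow_one] at h
  refine h.trans ?_
  have hz1 : ‖β * (A : ℂ)‖ ≤ M2 := hz.trans (by
    calc ‖β‖ * M2 ≤ 1 * M2 := mul_le_mul_of_nonneg_right hβ.le hM2pos
      _ = M2 := one_mul _)
  calc ‖β * (A : ℂ)‖ * Real.exp ‖β * (A : ℂ)‖ ≤ ‖β‖ * M2 * Real.exp M2 :=
        mul_le_mul hz (Real.exp_le_exp.2 hz1) (Real.exp_pos _).le (by positivity)
    _ = M2 * Real.exp M2 * ‖β‖ ^ 1 := by ring

end Weights

/-! ## 2. Measurability and bounds of the doubled slab factors -/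

section Factors

variable (hD : D.Bounds Ma Ms)
include hD

/-- The doubled slab factor is measurable on the replica space. [folklore] -/
theorem measurable_dT (β : ℂ) (h : Fin (n + 1)) : Measurable (dT D μV c g β h) := by
  unfold dT
  have m1 : Measurable fun q : (Fin (n + 1) → E) × (Fin (n + 1) → E) => (q.1 h, q.1 (h + 1)) :=
    ((measurable_pi_apply h).comp measurable_fst).prodMk
      ((measurable_pi_apply (h + 1)).comp measurable_fst)
  have m2 : Measurable fun q : (Fin (n + 1) → E) × (Fin (n + 1) → E) => (q.2 h, q.2 (h + 1)) :=
    ((measurable_pi_apply h).comp measurable_snd).prodMk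
      ((measurable_pi_apply (h + 1)).comp measurable_snd)
  exact (((measurable_kernel hD μV β h).comp m1).mul ((measurable_kernel hD μV β h).comp m2)).sub
    measurable_const

/-- A bound of the doubled slab factor at fixed `β`. [folklore] -/
theorem norm_dT_le (β : ℂ) (h : Fin (n + 1)) (q : (Fin (n + 1) → E) × (Fin (n + 1) → E)) :
    ‖dT D μV c g β h q‖ ≤ Real.exp (‖β‖ * Ms) * Real.exp (‖β‖ * Ms) + ‖cpoly c g h β‖ ^ 2 := by
  unfold dT
  refine (norm_sub_le _ _).trans (add_le_add ?_ (by rw [norm_pow]))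
  rw [norm_mul]
  exact mul_le_mul (norm_kernel_le hD μV β h _ _) (norm_kernel_le hD μV β h _ _) (norm_nonneg _)
    (Real.exp_pos _).le

/-- The product of doubled slab factors over `S` is measurable and bounded at fixed `β`. [folklore] -/
theorem measurable_prod_dT (β : ℂ) (S : Finset (Fin (n + 1))) :
    Measurable fun q : (Fin (n + 1) → E) × (Fin (n + 1) → E) => ∏ h ∈ S, dT D μV c g β h q :=
  Finset.measurable_prod _ fun h _ => measurable_dT μV hD β h

/-- Bound of the product of doubled slab factors at fixed `β`. [folklore] -/
theorem norm_prod_dT_le (β : ℂ) (S : Finset (Fin (n + 1)))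
    (q : (Fin (n + 1) → E) × (Fin (n + 1) → E)) :
    ‖∏ h ∈ S, dT D μV c g β h q‖ ≤
      ∏ h ∈ S, (Real.exp (‖β‖ * Ms) * Real.exp (‖β‖ * Ms) + ‖cpoly c g h β‖ ^ 2) := by
  rw [norm_prod]
  exact prod_le_prod (fun _ _ => norm_nonneg _) fun h _ => norm_dT_le μV hD β h q

end Factors

/-! ## 3. The three kinds of terms -/

section Terms

variable (hD : D.Bounds Ma Ms) (hM : D.Moments μV g c ρ) (hg : 1 ≤ g)
  (hρm : ∀ h, Measurable (Function.uncurry (ρ h))) (hρb : ∀ h e e', ‖ρ h e e'‖ ≤ Mρ)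
  (hρ₁ : ∀ h e', ∫ e, ρ h e e' ∂μ = 0) (hρ₂ : ∀ h e, ∫ e', ρ h e e' ∂μ = 0)
  (hxm : Measurable x) (hym : Measurable y) (hxb : ∀ e, |x e| ≤ Bx) (hyb : ∀ e, |y e| ≤ By)

include hD hxb hyb in
/-- The replica observable times the layer weights is `UnifO 0`. [folklore] -/
theorem replicaObs_layerWeight_unifO :
    UnifO 0 (fun β (q : (Fin (n + 1) → E) × (Fin (n + 1) → E)) =>
      (((x (q.1 0) - x (q.2 0)) * (y (q.1 τ) - y (q.2 τ)) : ℝ) : ℂ) *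
        (D.layerWeight β q.1 * D.layerWeight β q.2)) := by
  have h1 : UnifO 0 (fun (_ : ℂ) (q : (Fin (n + 1) → E) × (Fin (n + 1) → E)) =>
      (((x (q.1 0) - x (q.2 0)) * (y (q.1 τ) - y (q.2 τ)) : ℝ) : ℂ)) :=
    UnifO.of_norm_le fun _ q => norm_replicaObs_le hxb hyb q
  simpa using h1.mul (layerWeight_mul_unifO hD)

include hD hM hg hρb hxb hyb in
/-- **Terms with many slabs are small**: if `τ + 1 ≤ #S` then the term of `S` is `O(β^{gτ+1})`.
[folklore] -/
theorem slabTerm_isBigO_of_card {S : Finset (Fin (n + 1))} (hS : τ.val + 1 ≤ S.card) :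
    (fun β => ∫ q, (((x (q.1 0) - x (q.2 0)) * (y (q.1 τ) - y (q.2 τ)) : ℝ) : ℂ) *
        (D.layerWeight β q.1 * D.layerWeight β q.2) * ∏ h ∈ S, dT D μV c g β h q
        ∂((Measure.pi fun _ : Fin (n + 1) => μ).prod (Measure.pi fun _ : Fin (n + 1) => μ)))
      =O[𝓝 (0 : ℂ)] fun β => β ^ (g * τ.val + 1) := by
  haveI : Nonempty E := nonempty_of_prob μ
  have hprod : UnifO (∑ h ∈ S, g) (fun β (q : (Fin (n + 1) → E) × (Fin (n + 1) → E)) =>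
      ∏ h ∈ S, dT D μV c g β h q) :=
    UnifO.prod S fun h _ => dT_unifO μV hD hM hg hρb h
  rw [sum_const, smul_eq_mul] at hprod
  have hall := (replicaObs_layerWeight_unifO (τ := τ) hD hxb hyb).mul hprod
  rw [zero_add] at hall
  have hmono : UnifO (g * τ.val + 1) (fun β (q : (Fin (n + 1) → E) × (Fin (n + 1) → E)) =>
      (((x (q.1 0) - x (q.2 0)) * (y (q.1 τ) - y (q.2 τ)) : ℝ) : ℂ) *
        (D.layerWeight β q.1 * D.layerWeight β q.2) * ∏ h ∈ S, dT D μV c g β h q) := by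
    refine hall.mono ?_
    calc g * τ.val + 1 ≤ g * τ.val + g := by omega
      _ = g * (τ.val + 1) := by ring
      _ ≤ g * S.card := Nat.mul_le_mul_left g hS
      _ = S.card * g := mul_comm _ _
  exact hmono.isBigO_integral _

include hD hM hg hρm hρb hρ₁ hρ₂ hxm hym hxb hyb in
/-- **The short arc gives the leading term**: the term of `S = [0, τ)` is `2 b β^{gτ} + O(β^{gτ+1})`.
[folklore] -/
theorem slabTerm_Iio_sub_isBigO (hτ1 : 1 ≤ τ.val) :
    (fun β => ∫ q, (((x (q.1 0) - x (q.2 0)) * (y (q.1 τ) - y (q.2 τ)) : ℝ) : ℂ) *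
        (D.layerWeight β q.1 * D.layerWeight β q.2) * ∏ h ∈ Iio τ, dT D μV c g β h q
        ∂((Measure.pi fun _ : Fin (n + 1) => μ).prod (Measure.pi fun _ : Fin (n + 1) => μ)) -
        2 * (∫ η, (x (η 0) : ℂ) * (y (η τ) : ℂ) * chainProd ρ (Iio τ) η
          ∂(Measure.pi fun _ : Fin (n + 1) => μ)) * β ^ (g * τ.val))
      =O[𝓝 (0 : ℂ)] fun β => β ^ (g * τ.val + 1) := by
  haveI : Nonempty E := nonempty_of_prob μ
  set ν2 := (Measure.pi fun _ : Fin (n + 1) => μ).prod (Measure.pi fun _ : Fin (n + 1) => μ)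
    with hν2
  -- names
  set R : (Fin (n + 1) → E) × (Fin (n + 1) → E) → ℂ :=
    fun q => (((x (q.1 0) - x (q.2 0)) * (y (q.1 τ) - y (q.2 τ)) : ℝ) : ℂ) with hR
  set P : (Fin (n + 1) → E) × (Fin (n + 1) → E) → ℂ :=
    fun q => ∏ h ∈ Iio τ, (ρ h (q.1 h) (q.1 (h + 1)) + ρ h (q.2 h) (q.2 (h + 1))) with hP
  -- the leading identity
  have hlead : ∫ q, R q * P q ∂ν2 = 2 * ∫ η, (x (η 0) : ℂ) * (y (η τ) : ℂ) *
      chainProd ρ (Iio τ) η ∂(Measure.pi fun _ : Fin (n + 1) => μ) :=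
    replica_leading_eq_two_mul μ hρm hρb hρ₁ hρ₂ hxm hym hxb hyb hτ1
  -- uniform structure of the integrand
  have hMρ : 0 ≤ Mρ := (norm_nonneg _).trans (hρb 0 (Classical.arbitrary E) (Classical.arbitrary E))
  have hPb : ∀ h ∈ Iio τ, ∀ q : (Fin (n + 1) → E) × (Fin (n + 1) → E),
      ‖ρ h (q.1 h) (q.1 (h + 1)) + ρ h (q.2 h) (q.2 (h + 1))‖ ≤ 2 * Mρ := by
    intro h _ q
    refine (norm_add_le _ _).trans ?_
    have e1 := hρb h (q.1 h) (q.1 (h + 1))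
    have e2 := hρb h (q.2 h) (q.2 (h + 1))
    linarith
  have hprod := UnifO.prod_leading (Iio τ) hPb fun h _ => dT_leading_unifO μV hD hM hg hρb h
  rw [Fin.card_Iio] at hprod
  have hW1 := layerWeight_mul_sub_one_unifO hD
  have hW0 := layerWeight_mul_unifO hD
  have hR0 : UnifO 0 (fun (_ : ℂ) q => R q) := UnifO.of_norm_le fun _ q => norm_replicaObs_le hxb hyb q
  have hT : UnifO (g * τ.val) (fun β (q : (Fin (n + 1) → E) × (Fin (n + 1) → E)) =>
      ∏ h ∈ Iio τ, dT D μV c g β h q) := by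
    have h := UnifO.prod (Iio τ) fun h _ => dT_unifO μV hD hM hg hρb h
    rw [sum_const, smul_eq_mul, Fin.card_Iio, mul_comm] at h
    exact h
  -- `R W ∏T − β^{gτ} R P = R ((W − 1) ∏T + (∏T − β^{gτ} P))`
  have hdiff : UnifO (g * τ.val + 1) (fun β q =>
      R q * (D.layerWeight β q.1 * D.layerWeight β q.2) * ∏ h ∈ Iio τ, dT D μV c g β h q -
        β ^ (g * τ.val) * (R q * P q)) := by
    have h1 : UnifO (g * τ.val + 1) (fun β (q : (Fin (n + 1) → E) × (Fin (n + 1) → E)) =>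
        (D.layerWeight β q.1 * D.layerWeight β q.2 - 1) * ∏ h ∈ Iio τ, dT D μV c g β h q) :=
      (hW1.mul hT).mono (by omega)
    have hs := h1.add hprod
    have h2 := (hR0.mul hs).mono (show g * τ.val + 1 ≤ 0 + (g * τ.val + 1) by omega)
    refine h2.congr' fun β q => ?_
    simp only [hP]
    ring
  -- integrate
  have hint := hdiff.isBigO_integral ν2
  refine hint.congr' ?_ EventuallyEq.rfl
  filter_upwards with β
  have iA : Integrable (fun q => R q * (D.layerWeight β q.1 * D.layerWeight β q.2) *
      ∏ h ∈ Iio τ, dT D μV c g β h q) ν2 := by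
    refine Integrable.of_bound ?_ ((2 * Bx) * (2 * By) * Real.exp (‖β‖ * (2 * ((n + 1) * Ma))) *
      ∏ h ∈ Iio τ, (Real.exp (‖β‖ * Ms) * Real.exp (‖β‖ * Ms) + ‖cpoly c g h β‖ ^ 2))
      (Eventually.of_forall fun q => ?_)
    · refine Measurable.aestronglyMeasurable ?_
      refine ((Complex.measurable_ofReal.comp ?_).mul
        (((measurable_layerWeight hD β).comp measurable_fst).mul
          ((measurable_layerWeight hD β).comp measurable_snd))).mul (measurable_prod_dT μV hD β _)
      exact ((hxm.comp ((measurable_pi_apply 0).comp measurable_fst)).sub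
        (hxm.comp ((measurable_pi_apply 0).comp measurable_snd))).mul
        ((hym.comp ((measurable_pi_apply τ).comp measurable_fst)).sub
          (hym.comp ((measurable_pi_apply τ).comp measurable_snd)))
    · rw [norm_mul, norm_mul]
      have hBx : 0 ≤ Bx := (abs_nonneg _).trans (hxb (q.1 0))
      have hBy : 0 ≤ By := (abs_nonneg _).trans (hyb (q.1 τ))
      have h4 : 0 ≤ (2 * Bx) * (2 * By) := mul_nonneg (by linarith) (by linarith)
      exact mul_le_mul (mul_le_mul (norm_replicaObs_le hxb hyb q) (norm_layerWeight_mul_le hD β q)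
        (norm_nonneg _) h4) (norm_prod_dT_le μV hD β _ q) (norm_nonneg _)
        (mul_nonneg h4 (Real.exp_pos _).le)
  have iB : Integrable (fun q => β ^ (g * τ.val) * (R q * P q)) ν2 := by
    refine Integrable.of_bound ?_ (‖β‖ ^ (g * τ.val) * ((2 * Bx) * (2 * By) * (2 * Mρ) ^ τ.val))
      (Eventually.of_forall fun q => ?_)
    · refine Measurable.aestronglyMeasurable (((Complex.measurable_ofReal.comp ?_).mul ?_).const_mul _)
      · exact ((hxm.comp ((measurable_pi_apply 0).comp measurable_fst)).sub
          (hxm.comp ((measurable_pi_apply 0).comp measurable_snd))).mul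
          ((hym.comp ((measurable_pi_apply τ).comp measurable_fst)).sub
            (hym.comp ((measurable_pi_apply τ).comp measurable_snd)))
      · refine Finset.measurable_prod _ fun h _ => ?_
        have m1 : Measurable fun q : (Fin (n + 1) → E) × (Fin (n + 1) → E) => (q.1 h, q.1 (h + 1)) :=
          ((measurable_pi_apply h).comp measurable_fst).prodMk
            ((measurable_pi_apply (h + 1)).comp measurable_fst)
        have m2 : Measurable fun q : (Fin (n + 1) → E) × (Fin (n + 1) → E) => (q.2 h, q.2 (h + 1)) :=
          ((measurable_pi_apply h).comp measurable_snd).prodMk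
            ((measurable_pi_apply (h + 1)).comp measurable_snd)
        exact ((hρm h).comp m1).add ((hρm h).comp m2)
    · rw [norm_mul, norm_pow, norm_mul]
      refine mul_le_mul_of_nonneg_left ?_ (by positivity)
      have hBx : 0 ≤ Bx := (abs_nonneg _).trans (hxb (q.1 0))
      have hBy : 0 ≤ By := (abs_nonneg _).trans (hyb (q.1 τ))
      refine mul_le_mul (norm_replicaObs_le hxb hyb q) ?_ (norm_nonneg _)
        (mul_nonneg (by linarith) (by linarith))
      rw [hP, norm_prod, ← Fin.card_Iio τ, ← prod_const]
      exact prod_le_prod (fun _ _ => norm_nonneg _) fun h hh => hPb h hh q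
  show ∫ q, (R q * (D.layerWeight β q.1 * D.layerWeight β q.2) * ∏ h ∈ Iio τ, dT D μV c g β h q -
      β ^ (g * τ.val) * (R q * P q)) ∂ν2 = _
  rw [integral_sub iA iB, integral_const_mul, hlead]
  ring

end Terms

end Summit.Ventures.LatticeQCDFlow.Theory2.SlabChain

end
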